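import Summits.CriticalPhenomena.PercolationContinuityZ3.Theorems.PercNearOneGluingNoHeavyLowerTailSahiCombMasterFamily
import Summits.CriticalPhenomena.PercolationContinuityZ3.Theorems.SahiMasterFamilyEqPrincipal
import Summits.CriticalPhenomena.PercolationContinuityZ3.Theorems.SahiMasterFamilyMeetStratum

/-!
# The comb (tensor-Bernstein) hierarchy for Sahi's `E_k`, XX-A: DISJUNCTIVE CLOSURE AT ORDER 3, the identities — the one-coordinate
# Bernstein pieces of `E_3` when a fresh coordinate is OR-ed into a sub-collection of the members (explicit, manifestly nonnegative)

Support file of the one-cut programme (crux `NoHeavyLowerTail`, stmt-CriticalPhenomena-4575; cell `prim-masterthm`, seat P3, gen 4;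
`run/shared/lean/prim/prim-masterthm/prim-masterthm-p3/HIERARCHY.md` §11).  Vocabulary: `SahiComb.CombPos`, `covFun` and (M⁺-2) `combPos_covFun`
(`…SahiCombMasterFamily`), the `e`-sections `secAt` (`…SahiMasterFamilyMinors`).

THE POINT.  HIERARCHY §3 ("why no coordinate induction") records that the one-coordinate Bernstein pieces of `E_3` are signed in general.
For a coordinate `e` that enters the members only as a DISJUNCT — `V_j = U_j ∪ {e ∈ ω}` for `j ∈ G`, `V_j = U_j` otherwise, the `U_j` ignoring
`e` — they are NOT: writing `t = p_e`, `m_R = μ_p(⋂_{j∈R} U_j)`,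
* `|G| = 1`: `E_3(V) = (1−t)·E_3(U) + t·Cov(U_1,U_2)` (affine: the private-coordinate case of `…SahiCombPrivate`);
* `|G| = 2`: `E_3(V) = (1−t)²·E_3(U) + t(1−t)·[Cov(1_{U_0∩U_1}, 1_{U_2}) + μ(U_0ᶜ ∩ U_1ᶜ ∩ U_2)]`;
* `|G| = 3`: `E_3(V) = (1−t)³·E_3(U) + ½t(1−t)²·[X + 2s₁ + q_∅ + 3q_∅² + 2P₁ + 3q_∅s₁ + R + q_∅s₂] + t²(1−t)·[q_∅ + s₁]`, where
  `X = Σ_k Cov(1_{U_k}, 1_{U_i∩U_j})`, `q_∅ = μ(no U_j)`, `q_i = μ(only U_i)`, `q_{ij} = μ(exactly U_i,U_j)`, `s₁ = Σq_i`, `s₂ = Σq_{ij}`,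
  `P₁ = Σ_{i<j} q_iq_j`, `R = Σ_i q_i q_{jk}` (an exact LP over Venn-cell products found this manifestly nonnegative form; `ring` checks it).
This file: the three identities `sahiE_three_unionCoord_one/two/three` (sections `secAt`, one-coordinate conditioning `ex_ind_eq_secAt`,
Venn-cell moment expansions, `ring`) and the invariance in `p_e` of all the pieces (`sahiE_three_U_update`, `covFun_UU_update`,
`ex_cellFun_update`).  The comb-positivity consequences (every bracket is a nonnegative combination of (M⁺-2) covariances of increasing
events and moments of nonnegative functions), the closure theorem for any sub-collection, the disjunctive padding of a comb-positive triple
by an independent OR-system and the certificate-free (M⁺-3) for OR-triples are in the companion `…SahiCombDisjunctThreeComb`.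
The numerically supported all-order form (MIXTURE CONJECTURE, HIERARCHY §11: OR-ing / AND-ing an independent event into a sub-collection of an
all-orders-positive family keeps it all-orders positive, Bernstein-positively in the mixing parameter) is NOT asserted here.
HONEST FRAMING: nothing here asserts (M⁺-k) or `C_k` for `k ≥ 3` in general. [this work]
-/

noncomputable section

open scoped Classical

namespace Summit.CriticalPhenomena.PercolationContinuityZ3.Theorems

open Finset Function
open Literature.Combinatorics.Sahi2008
open Literature.Probability.Percolation.BHK2006 (ind_inter)
open Literature.Probability.Percolation.DecisionTree (ind ind_of_mem ind_of_not_mem ind_nonneg)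
open SahiComb

variable {ι : Type} [Fintype ι]

namespace SahiCombDisjunct

/-! ### Sections at the new coordinate -/

omit [Fintype ι] in
/-- Sections commute with unions. [folklore] -/
theorem secAt_union (e : ι) (b : Bool) (A B : Set (Set ι)) : secAt e b (A ∪ B) = secAt e b A ∪ secAt e b B := by
  cases b <;> rfl

omit [Fintype ι] in
/-- The `1`-section of the coordinate event `{e ∈ ω}` is everything. [folklore] -/
theorem secAt_true_coord (e : ι) : secAt e true {ω : Set ι | e ∈ ω} = Set.univ := by
  ext ω; simp [mem_secAt, forceAt]

omit [Fintype ι] in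
/-- The `0`-section of the coordinate event `{e ∈ ω}` is empty. [folklore] -/
theorem secAt_false_coord (e : ι) : secAt e false {ω : Set ι | e ∈ ω} = ∅ := by
  ext ω; simp [mem_secAt, forceAt]

/-- `μ_p(everything) = 1`. [folklore] -/
theorem ex_ind_univ (p : ι → unitInterval) : ex (bernoulliWeight p) (ind (Set.univ : Set (Set ι))) = 1 := by
  rw [ex_def]
  have : ∀ ω : Set ι, bernoulliWeight p ω * ind (Set.univ : Set (Set ι)) ω = bernoulliWeight p ω := fun ω => by
    rw [ind_of_mem (Set.mem_univ ω), mul_one]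
  simp only [this, sum_bernoulliWeight]

/-- `μ_p(∅) = 0`. [folklore] -/
theorem ex_ind_empty (p : ι → unitInterval) : ex (bernoulliWeight p) (ind (∅ : Set (Set ι))) = 0 := by
  rw [ex_def]
  exact Finset.sum_eq_zero fun ω _ => by rw [ind_of_not_mem (Set.notMem_empty ω), mul_zero]

/-- **One-coordinate conditioning for an event built from `e`-ignoring events and the coordinate event**: if `X^{e←1} = Y₁` and
`X^{e←0} = Y₀` then `μ_p(X) = p_e μ_p(Y₁) + (1 − p_e) μ_p(Y₀)`. [folklore] -/
theorem ex_ind_of_secAt (p : ι → unitInterval) (e : ι) {X Y₁ Y₀ : Set (Set ι)} (h1 : secAt e true X = Y₁) (h0 : secAt e false X = Y₀) :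
    ex (bernoulliWeight p) (ind X) = (p e : ℝ) * ex (bernoulliWeight p) (ind Y₁) + (1 - (p e : ℝ)) * ex (bernoulliWeight p) (ind Y₀) := by
  rw [ex_ind_eq_secAt p e X, h1, h0]

/-! ### Venn-cell moments of three events -/

/-- `ex` is additive under subtraction. [folklore] -/
theorem ex_sub' (μ f g : Set ι → ℝ) : ex μ (f - g) = ex μ f - ex μ g := by
  simp only [ex_def, Pi.sub_apply, mul_sub, Finset.sum_sub_distrib]

/-- `μ((1−a)(1−b)c) = m_c − m_ac − m_bc + m_abc`. [folklore] -/
theorem ex_cell_one (μ : Set ι → ℝ) (A B C : Set (Set ι)) :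
    ex μ (fun ω => (1 - ind A ω) * (1 - ind B ω) * ind C ω) =
      ex μ (ind C) - ex μ (ind (A ∩ C)) - ex μ (ind (B ∩ C)) + ex μ (ind (A ∩ B ∩ C)) := by
  have hf : (fun ω => (1 - ind A ω) * (1 - ind B ω) * ind C ω) = ind C - ind (A ∩ C) - ind (B ∩ C) + ind (A ∩ B ∩ C) := by
    funext ω
    simp only [Pi.add_apply, Pi.sub_apply]
    simp only [ind_inter]; ring
  rw [hf, ex_add, ex_sub', ex_sub']

/-- `μ(ab(1−c)) = m_ab − m_abc`. [folklore] -/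
theorem ex_cell_two (μ : Set ι → ℝ) (A B C : Set (Set ι)) :
    ex μ (fun ω => ind A ω * ind B ω * (1 - ind C ω)) = ex μ (ind (A ∩ B)) - ex μ (ind (A ∩ B ∩ C)) := by
  have hf : (fun ω => ind A ω * ind B ω * (1 - ind C ω)) = ind (A ∩ B) - ind (A ∩ B ∩ C) := by
    funext ω
    simp only [Pi.sub_apply]
    simp only [ind_inter]; ring
  rw [hf, ex_sub']

/-- `μ((1−a)(1−b)(1−c)) = 1 − m_a − m_b − m_c + m_ab + m_ac + m_bc − m_abc` under a product weight. [folklore] -/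
theorem ex_cell_none (p : ι → unitInterval) (A B C : Set (Set ι)) :
    ex (bernoulliWeight p) (fun ω => (1 - ind A ω) * (1 - ind B ω) * (1 - ind C ω)) =
      1 - ex (bernoulliWeight p) (ind A) - ex (bernoulliWeight p) (ind B) - ex (bernoulliWeight p) (ind C)
        + ex (bernoulliWeight p) (ind (A ∩ B)) + ex (bernoulliWeight p) (ind (A ∩ C)) + ex (bernoulliWeight p) (ind (B ∩ C))
        - ex (bernoulliWeight p) (ind (A ∩ B ∩ C)) := by
  have hf : (fun ω => (1 - ind A ω) * (1 - ind B ω) * (1 - ind C ω)) =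
      1 - ind A - ind B - ind C + ind (A ∩ B) + ind (A ∩ C) + ind (B ∩ C) - ind (A ∩ B ∩ C) := by
    funext ω
    simp only [Pi.add_apply, Pi.sub_apply, Pi.one_apply]
    simp only [ind_inter]; ring
  rw [hf]
  simp only [ex_sub', ex_add, ex_one (sum_bernoulliWeight p)]

/-! ### The three identities -/

section Identities

variable (U : Fin 3 → Set (Set ι)) (e : ι) (hUe : ∀ (j : Fin 3) (b : Bool), secAt e b (U j) = U j) (p : ι → unitInterval)
include hUe

attribute [local simp] secAt_inter secAt_union secAt_true_coord secAt_false_coord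

omit [Fintype ι] in
/-- Intersections of the `U_j` ignore `e`. [folklore] -/
theorem secAt_inter_U (b : Bool) (i j : Fin 3) : secAt e b (U i ∩ U j) = U i ∩ U j := by
  rw [secAt_inter, hUe, hUe]

omit [Fintype ι] in
/-- The triple intersection ignores `e`. [folklore] -/
theorem secAt_inter3_U (b : Bool) : secAt e b (U 0 ∩ U 1 ∩ U 2) = U 0 ∩ U 1 ∩ U 2 := by
  rw [secAt_inter, secAt_inter, hUe, hUe, hUe]

/-- **`|G| = 1`**: `E_3(1_{U_0 ∪ {e∈ω}}, 1_{U_1}, 1_{U_2}) = (1 − p_e)·E_3(1_U) + p_e·Cov(U_1,U_2)`. [this work] -/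
theorem sahiE_three_unionCoord_one :
    sahiE (bernoulliWeight p) 3 ![ind (U 0 ∪ {ω : Set ι | e ∈ ω}), ind (U 1), ind (U 2)] =
      (1 - (p e : ℝ)) * sahiE (bernoulliWeight p) 3 ![ind (U 0), ind (U 1), ind (U 2)] + (p e : ℝ) * covFun (U 1) (U 2) p := by
  have hs := secAt_inter_U U e hUe
  have h0 : ex (bernoulliWeight p) (ind (U 0 ∪ {ω : Set ι | e ∈ ω})) =
      (p e : ℝ) * ex (bernoulliWeight p) (ind Set.univ) + (1 - (p e : ℝ)) * ex (bernoulliWeight p) (ind (U 0)) :=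
    ex_ind_of_secAt p e (by simp [hUe])
      (by simp [hUe])
  have h01 : ex (bernoulliWeight p) (ind ((U 0 ∪ {ω : Set ι | e ∈ ω}) ∩ U 1)) =
      (p e : ℝ) * ex (bernoulliWeight p) (ind (U 1)) + (1 - (p e : ℝ)) * ex (bernoulliWeight p) (ind (U 0 ∩ U 1)) :=
    ex_ind_of_secAt p e (by simp [hUe])
      (by simp [hUe])
  have h02 : ex (bernoulliWeight p) (ind ((U 0 ∪ {ω : Set ι | e ∈ ω}) ∩ U 2)) =
      (p e : ℝ) * ex (bernoulliWeight p) (ind (U 2)) + (1 - (p e : ℝ)) * ex (bernoulliWeight p) (ind (U 0 ∩ U 2)) :=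
    ex_ind_of_secAt p e (by simp [hUe])
      (by simp [hUe])
  have h012 : ex (bernoulliWeight p) (ind ((U 0 ∪ {ω : Set ι | e ∈ ω}) ∩ U 1 ∩ U 2)) =
      (p e : ℝ) * ex (bernoulliWeight p) (ind (U 1 ∩ U 2)) + (1 - (p e : ℝ)) * ex (bernoulliWeight p) (ind (U 0 ∩ U 1 ∩ U 2)) :=
    ex_ind_of_secAt p e
      (by simp [hUe])
      (by simp [hUe])
  rw [sahiE_three, sahiE_three, covFun]
  simp only [ind_mul_ind_eq_inter]
  rw [h0, h01, h02, h012, ex_ind_univ]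
  ring

/-- **`|G| = 2`**: `E_3(1_{U_0 ∪ {e}}, 1_{U_1 ∪ {e}}, 1_{U_2}) = (1−p_e)²·E_3(1_U) + p_e(1−p_e)·[Cov(1_{U_0∩U_1},1_{U_2}) + μ(U_0ᶜU_1ᶜU_2)]`.
[this work] -/
theorem sahiE_three_unionCoord_two :
    sahiE (bernoulliWeight p) 3 ![ind (U 0 ∪ {ω : Set ι | e ∈ ω}), ind (U 1 ∪ {ω : Set ι | e ∈ ω}), ind (U 2)] =
      (1 - (p e : ℝ)) ^ 2 * sahiE (bernoulliWeight p) 3 ![ind (U 0), ind (U 1), ind (U 2)] +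
        (p e : ℝ) * (1 - (p e : ℝ)) * (covFun (U 0 ∩ U 1) (U 2) p +
          ex (bernoulliWeight p) (fun ω => (1 - ind (U 0) ω) * (1 - ind (U 1) ω) * ind (U 2) ω)) := by
  have h0 : ex (bernoulliWeight p) (ind (U 0 ∪ {ω : Set ι | e ∈ ω})) =
      (p e : ℝ) * ex (bernoulliWeight p) (ind Set.univ) + (1 - (p e : ℝ)) * ex (bernoulliWeight p) (ind (U 0)) :=
    ex_ind_of_secAt p e (by simp [hUe]) (by simp [hUe])
  have h1 : ex (bernoulliWeight p) (ind (U 1 ∪ {ω : Set ι | e ∈ ω})) =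
      (p e : ℝ) * ex (bernoulliWeight p) (ind Set.univ) + (1 - (p e : ℝ)) * ex (bernoulliWeight p) (ind (U 1)) :=
    ex_ind_of_secAt p e (by simp [hUe]) (by simp [hUe])
  have h01 : ex (bernoulliWeight p) (ind ((U 0 ∪ {ω : Set ι | e ∈ ω}) ∩ (U 1 ∪ {ω : Set ι | e ∈ ω}))) =
      (p e : ℝ) * ex (bernoulliWeight p) (ind Set.univ) + (1 - (p e : ℝ)) * ex (bernoulliWeight p) (ind (U 0 ∩ U 1)) :=
    ex_ind_of_secAt p e (by simp [hUe])
      (by simp [hUe])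
  have h02 : ex (bernoulliWeight p) (ind ((U 0 ∪ {ω : Set ι | e ∈ ω}) ∩ U 2)) =
      (p e : ℝ) * ex (bernoulliWeight p) (ind (U 2)) + (1 - (p e : ℝ)) * ex (bernoulliWeight p) (ind (U 0 ∩ U 2)) :=
    ex_ind_of_secAt p e (by simp [hUe])
      (by simp [hUe])
  have h12 : ex (bernoulliWeight p) (ind ((U 1 ∪ {ω : Set ι | e ∈ ω}) ∩ U 2)) =
      (p e : ℝ) * ex (bernoulliWeight p) (ind (U 2)) + (1 - (p e : ℝ)) * ex (bernoulliWeight p) (ind (U 1 ∩ U 2)) :=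
    ex_ind_of_secAt p e (by simp [hUe])
      (by simp [hUe])
  have h012 : ex (bernoulliWeight p) (ind ((U 0 ∪ {ω : Set ι | e ∈ ω}) ∩ (U 1 ∪ {ω : Set ι | e ∈ ω}) ∩ U 2)) =
      (p e : ℝ) * ex (bernoulliWeight p) (ind (U 2)) + (1 - (p e : ℝ)) * ex (bernoulliWeight p) (ind (U 0 ∩ U 1 ∩ U 2)) :=
    ex_ind_of_secAt p e
      (by simp [hUe])
      (by simp [hUe])
  rw [sahiE_three, sahiE_three, covFun, ex_cell_one]
  simp only [ind_mul_ind_eq_inter]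
  rw [h0, h1, h01, h02, h12, h012, ex_ind_univ]
  ring

/-- **`|G| = 3`**: with all three members OR-ed with `{e ∈ ω}`, `E_3(1_V) = (1−t)³E_3(1_U) + ½t(1−t)²·[X + 2s₁ + q_∅ + 3q_∅² + 2P₁ + 3q_∅s₁
+ R + q_∅s₂] + t²(1−t)·[q_∅ + s₁]` (`t = p_e`; notation of the file header; every bracketed term nonnegative). [this work] -/
theorem sahiE_three_unionCoord_three :
    let m := ex (bernoulliWeight p)
    let q0 := m (fun ω => (1 - ind (U 0) ω) * (1 - ind (U 1) ω) * (1 - ind (U 2) ω))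
    let qa := m (fun ω => (1 - ind (U 1) ω) * (1 - ind (U 2) ω) * ind (U 0) ω)
    let qb := m (fun ω => (1 - ind (U 0) ω) * (1 - ind (U 2) ω) * ind (U 1) ω)
    let qc := m (fun ω => (1 - ind (U 0) ω) * (1 - ind (U 1) ω) * ind (U 2) ω)
    let qab := m (fun ω => ind (U 0) ω * ind (U 1) ω * (1 - ind (U 2) ω))
    let qac := m (fun ω => ind (U 0) ω * ind (U 2) ω * (1 - ind (U 1) ω))
    let qbc := m (fun ω => ind (U 1) ω * ind (U 2) ω * (1 - ind (U 0) ω))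
    let X := covFun (U 1 ∩ U 2) (U 0) p + covFun (U 0 ∩ U 2) (U 1) p + covFun (U 0 ∩ U 1) (U 2) p
    sahiE (bernoulliWeight p) 3
        ![ind (U 0 ∪ {ω : Set ι | e ∈ ω}), ind (U 1 ∪ {ω : Set ι | e ∈ ω}), ind (U 2 ∪ {ω : Set ι | e ∈ ω})] =
      (1 - (p e : ℝ)) ^ 3 * sahiE (bernoulliWeight p) 3 ![ind (U 0), ind (U 1), ind (U 2)] +
        (1 / 2) * ((p e : ℝ) * (1 - (p e : ℝ)) ^ 2) *
          (X + 2 * (qa + qb + qc) + q0 + 3 * q0 ^ 2 + 2 * (qa * qb + qa * qc + qb * qc) + 3 * (q0 * (qa + qb + qc))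
            + (qa * qbc + qb * qac + qc * qab) + q0 * (qab + qac + qbc)) +
        ((p e : ℝ) ^ 2 * (1 - (p e : ℝ))) * (q0 + (qa + qb + qc)) := by
  intro m q0 qa qb qc qab qac qbc X
  have hsing : ∀ j : Fin 3, ex (bernoulliWeight p) (ind (U j ∪ {ω : Set ι | e ∈ ω})) =
      (p e : ℝ) * ex (bernoulliWeight p) (ind Set.univ) + (1 - (p e : ℝ)) * ex (bernoulliWeight p) (ind (U j)) := fun j =>
    ex_ind_of_secAt p e (by simp [hUe]) (by simp [hUe])
  have hpair : ∀ i j : Fin 3, ex (bernoulliWeight p) (ind ((U i ∪ {ω : Set ι | e ∈ ω}) ∩ (U j ∪ {ω : Set ι | e ∈ ω}))) =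
      (p e : ℝ) * ex (bernoulliWeight p) (ind Set.univ) + (1 - (p e : ℝ)) * ex (bernoulliWeight p) (ind (U i ∩ U j)) := fun i j =>
    ex_ind_of_secAt p e (by simp [hUe]) (by simp [hUe])
  have h012 : ex (bernoulliWeight p)
      (ind ((U 0 ∪ {ω : Set ι | e ∈ ω}) ∩ (U 1 ∪ {ω : Set ι | e ∈ ω}) ∩ (U 2 ∪ {ω : Set ι | e ∈ ω}))) =
      (p e : ℝ) * ex (bernoulliWeight p) (ind Set.univ) + (1 - (p e : ℝ)) * ex (bernoulliWeight p) (ind (U 0 ∩ U 1 ∩ U 2)) :=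
    ex_ind_of_secAt p e (by simp [hUe]) (by simp [hUe])
  -- normalise the intersections appearing in the cell expansions
  have i10 : U 1 ∩ U 0 = U 0 ∩ U 1 := Set.inter_comm _ _
  have i20 : U 2 ∩ U 0 = U 0 ∩ U 2 := Set.inter_comm _ _
  have i21 : U 2 ∩ U 1 = U 1 ∩ U 2 := Set.inter_comm _ _
  have i120 : U 1 ∩ U 2 ∩ U 0 = U 0 ∩ U 1 ∩ U 2 := by ext ω; simp only [Set.mem_inter_iff]; tauto
  have i021 : U 0 ∩ U 2 ∩ U 1 = U 0 ∩ U 1 ∩ U 2 := by ext ω; simp only [Set.mem_inter_iff]; tauto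
  simp only [m, q0, qa, qb, qc, qab, qac, qbc, X]
  rw [covFun, covFun, covFun, ex_cell_none, ex_cell_one, ex_cell_one, ex_cell_one, ex_cell_two, ex_cell_two, ex_cell_two,
    i10, i20, i21, i120, i021, sahiE_three, sahiE_three]
  simp only [ind_mul_ind_eq_inter]
  rw [hsing 0, hsing 1, hsing 2, hpair 0 1, hpair 0 2, hpair 1 2, h012, ex_ind_univ]
  ring

end Identities


/-- Moments of functions ignoring `e` do not depend on `p_e`. [folklore] -/
theorem ex_update_of_ignores' (e : ι) {h : Set ι → ℝ} (hh : ∀ ω, h (insert e ω) = h ω) (p : ι → unitInterval) (s : unitInterval) :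
    ex (bernoulliWeight (update p e s)) h = ex (bernoulliWeight p) h := by
  have := ex_update_eq_of_ignores p e s (p e) hh
  rwa [update_eq_self] at this

omit [Fintype ι] in
/-- Multidegree bookkeeping: `a·δ_e + (d off e, 0 at e) ≤ 3` for `a ≤ 3`, `d ≤ 3`. [folklore] -/
theorem deg_le_three (e : ι) {a d : ℕ} (ha : a ≤ 3) (hd : d ≤ 3) :
    (Pi.single e a + update (fun _ : ι => d) e 0) ≤ fun _ : ι => 3 := by
  intro x
  by_cases hx : x = e
  · subst hx; simp [ha]
  · simp [hx, hd]

/-- Powers of `p_e` and `1 − p_e`: `p_e^a (1−p_e)^b` is comb-positive at multidegree `(a+b)·δ_e`. [folklore] -/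
theorem combPos_coord_pow (e : ι) (a b : ℕ) :
    CombPos (Pi.single e (a + b)) (fun p : ι → unitInterval => (p e : ℝ) ^ a * (1 - (p e : ℝ)) ^ b) := by
  induction a with
  | zero =>
    induction b with
    | zero => exact (combPos_const (Pi.single e 0) zero_le_one).congr fun p => by simp
    | succ b ih =>
      exact (ih.mul_of_eq (combPos_one_sub_coord e) (by rw [← Pi.single_add, Nat.add_assoc])).congr fun p => by ring
  | succ a ih =>
    exact (ih.mul_of_eq (combPos_coord e) (by rw [← Pi.single_add]; congr 1; omega)).congr fun p => by ring

/-! ### Invariance in `p_e` of everything built from the `U_j` -/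

section Invariance

variable (U : Fin 3 → Set (Set ι)) (e : ι) (hUe : ∀ (j : Fin 3) (b : Bool), secAt e b (U j) = U j)
include hUe

omit [Fintype ι] in
/-- The indicators of the `U_j` ignore the coordinate `e`. [folklore] -/
theorem ind_U_insert (j : Fin 3) (ω : Set ι) : ind (U j) (insert e ω) = ind (U j) ω := by
  rw [← hUe j true]; exact ind_secAt_insert e true (U j) ω

/-- `μ_p(U_j)` does not depend on `p_e`. [folklore] -/
theorem ex_ind_U_update (j : Fin 3) (p : ι → unitInterval) (s : unitInterval) :
    ex (bernoulliWeight (update p e s)) (ind (U j)) = ex (bernoulliWeight p) (ind (U j)) :=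
  ex_update_of_ignores' e (fun ω => ind_U_insert U e hUe j ω) p s

/-- `μ_p(U_i ∩ U_j)` does not depend on `p_e`. [folklore] -/
theorem ex_ind_UU_update (i j : Fin 3) (p : ι → unitInterval) (s : unitInterval) :
    ex (bernoulliWeight (update p e s)) (ind (U i ∩ U j)) = ex (bernoulliWeight p) (ind (U i ∩ U j)) :=
  ex_update_of_ignores' e (fun ω => by rw [ind_inter, ind_inter, ind_U_insert U e hUe, ind_U_insert U e hUe]) p s

/-- `μ_p(U_0 ∩ U_1 ∩ U_2)` does not depend on `p_e`. [folklore] -/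
theorem ex_ind_UUU_update (p : ι → unitInterval) (s : unitInterval) :
    ex (bernoulliWeight (update p e s)) (ind (U 0 ∩ U 1 ∩ U 2)) = ex (bernoulliWeight p) (ind (U 0 ∩ U 1 ∩ U 2)) :=
  ex_update_of_ignores' e (fun ω => by
    rw [ind_inter, ind_inter, ind_inter, ind_inter, ind_U_insert U e hUe, ind_U_insert U e hUe, ind_U_insert U e hUe]) p s

/-- `E_3(1_U)` does not depend on `p_e`. [folklore] -/
theorem sahiE_three_U_update (p : ι → unitInterval) (s : unitInterval) :
    sahiE (bernoulliWeight (update p e s)) 3 ![ind (U 0), ind (U 1), ind (U 2)] =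
      sahiE (bernoulliWeight p) 3 ![ind (U 0), ind (U 1), ind (U 2)] := by
  rw [sahiE_three, sahiE_three]
  simp only [ind_mul_ind_eq_inter, ex_ind_U_update U e hUe, ex_ind_UU_update U e hUe, ex_ind_UUU_update U e hUe]

/-- `Cov(U_i, U_j)` does not depend on `p_e`. [folklore] -/
theorem covFun_U_update (i j : Fin 3) (p : ι → unitInterval) (s : unitInterval) :
    covFun (U i) (U j) (update p e s) = covFun (U i) (U j) p := by
  rw [covFun, covFun, ex_ind_U_update U e hUe, ex_ind_U_update U e hUe, ex_ind_UU_update U e hUe]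

/-- `Cov(U_i ∩ U_j, U_k)` does not depend on `p_e`. [folklore] -/
theorem covFun_UU_update (i j k : Fin 3) (p : ι → unitInterval) (s : unitInterval) :
    covFun (U i ∩ U j) (U k) (update p e s) = covFun (U i ∩ U j) (U k) p := by
  rw [covFun, covFun, ex_ind_U_update U e hUe, ex_ind_UU_update U e hUe]
  rw [ex_update_of_ignores' e (fun ω => by
    rw [ind_inter, ind_inter, ind_inter, ind_inter, ind_U_insert U e hUe, ind_U_insert U e hUe, ind_U_insert U e hUe]) p s]

/-- Moments of Venn-cell functions of the `U_j` (any polynomial expression in the three indicators) do not depend on `p_e`. [folklore] -/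
theorem ex_cellFun_update (F : ℝ → ℝ → ℝ → ℝ) (p : ι → unitInterval) (s : unitInterval) :
    ex (bernoulliWeight (update p e s)) (fun ω => F (ind (U 0) ω) (ind (U 1) ω) (ind (U 2) ω)) =
      ex (bernoulliWeight p) (fun ω => F (ind (U 0) ω) (ind (U 1) ω) (ind (U 2) ω)) :=
  ex_update_of_ignores' e (fun ω => by simp only [ind_U_insert U e hUe]) p s

end Invariance

end SahiCombDisjunct

end Summit.CriticalPhenomena.PercolationContinuityZ3.Theorems

end
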